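import Summits.CriticalPhenomena.PercolationContinuityZ3.Theorems.PercNearOneGluingNoHeavyQuantSDECPoint
import Summits.CriticalPhenomena.PercolationContinuityZ3.Theorems.PercNearOneGluingNoHeavyQuantSliceClosureBlobs
import HarnessLib

/-!
# QUANT lane R8, T-DEC: `SDECConvClosed` alone gives BLOB-DEC(k) for every k (blob laws are gate-stable DEC at their natural floor)

builds on p205010 (kernel theorem, internal audit signed; external expert review pending)

Support file (`--supports stmt-CriticalPhenomena-4575`), QUANT lane seat prim-quant-census-2 (gen 53), rung R8 of
`run/shared/lean/prim/quant/LADDER.md`.  Follow-up to `…QuantSDEC` (p267007), `…QuantSDECPoint` (p267742), `…QuantSliceClosureBlobs` (p268189);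
memo `…/prim-quant-census-2-g53/DEC-CLOSURE-G53.md` §4.  Theorems only, standard axioms.

* `LawDec.lconv_gate_point_eq_slice` — a slice is the convolution with a gated sure block: `lconv M a μ (gate δ_a g) = slice μ a g` for `μ` vanishing above `M`.
* `LawDec.blobSDEC_of_sdecConvClosed` — under `SDECConvClosed`, every finite family of independent heavy blobs (`1 ≤ a i`, `x ≤ p i < 1`, `0 < x < 1`)
  has a gate-stable DEC count law: `SDEC x (Σ a i) (blobLawOn s a p)` (Finset induction: `sdec_gate_point` + `sdec_mono` for the new blob, the conjecture for the sum).
* **`LawDec.blobDEC_on_of_sdecConvClosed : SDECConvClosed → … → ∀ j′, DECAt x j′ (Σ a i) (blobLawOn s a p)`** — so the single conjecture `SDECConvClosed`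
  covers the blob systems too (trees AND depth-1 forests); `SliceClosed` remains the weaker-hypothesis route for blobs.

[this work]; DEC rules ARCH-TREES-G49 §2.2 / DEC-TAMP-G50 §3.1 (this lane).  The gluing rows served [cite: KozmaNitzan2024, Conjecture 3 (p. 15)];
product measure [cite: Grimmett1999, §1.3 p. 10].
-/

noncomputable section

namespace Summit.CriticalPhenomena.PercolationContinuityZ3.Theorems

namespace Quant

open Finset

namespace LawDec

variable {ι : Type*} [DecidableEq ι]

omit [DecidableEq ι] in
/-- **A slice is a convolution with a gated sure block.** [this work] -/
theorem lconv_gate_point_eq_slice (M a : ℕ) (μ : ℕ → ℝ) (g : ℝ) (hμM : ∀ h, M < h → μ h = 0) :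
    lconv M a μ (gate (fun k => if k = a then (1 : ℝ) else 0) g) = slice μ a g := by
  funext h
  simp only [lconv, slice, gate]
  -- evaluate the inner sum over `k ∈ {0..a}`: only `k = a` (weight `g`) and `k = 0` (weight `1 − g`) are charged
  have inner : ∀ i : ℕ, ∑ k ∈ Finset.range (a + 1),
      (if i + k = h then μ i * (g * (if k = a then (1 : ℝ) else 0) + (if k = 0 then 1 - g else 0)) else 0)
      = μ i * (g * (if i + a = h then (1 : ℝ) else 0) + (1 - g) * (if i = h then (1 : ℝ) else 0)) := by
    intro i
    have e : ∀ k : ℕ, (if i + k = h then μ i * (g * (if k = a then (1 : ℝ) else 0) + (if k = 0 then 1 - g else 0)) else 0)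
        = μ i * g * (if k = a then (if i + k = h then (1 : ℝ) else 0) else 0)
          + μ i * (1 - g) * (if k = 0 then (if i + k = h then (1 : ℝ) else 0) else 0) := by
      intro k
      split_ifs <;> ring
    simp_rw [e]
    rw [Finset.sum_add_distrib, ← Finset.mul_sum, ← Finset.mul_sum, Finset.sum_ite_eq' (Finset.range (a + 1)) a,
      Finset.sum_ite_eq' (Finset.range (a + 1)) 0, if_pos (Finset.mem_range.2 (Nat.lt_succ_self a)),
      if_pos (Finset.mem_range.2 (Nat.succ_pos a)), add_zero]
    ring
  simp_rw [inner]
  have e2 : ∀ i : ℕ, μ i * (g * (if i + a = h then (1 : ℝ) else 0) + (1 - g) * (if i = h then (1 : ℝ) else 0))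
      = g * (μ i * (if h - a = i ∧ a ≤ h then (1 : ℝ) else 0)) + (1 - g) * (μ i * (if h = i then (1 : ℝ) else 0)) := by
    intro i
    have : (i + a = h) ↔ (h - a = i ∧ a ≤ h) := by omega
    simp only [this, eq_comm (a := i) (b := h)]
    ring
  simp_rw [e2]
  rw [Finset.sum_add_distrib, ← Finset.mul_sum, ← Finset.mul_sum]
  -- the two indicator sums
  have s0 : ∑ i ∈ Finset.range (M + 1), μ i * (if h = i then (1 : ℝ) else 0) = μ h := by
    rw [sum_indicator μ (M + 1) h]
    split_ifs with hh
    · rfl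
    · exact (hμM h (by omega)).symm
  have s1 : ∑ i ∈ Finset.range (M + 1), μ i * (if h - a = i ∧ a ≤ h then (1 : ℝ) else 0)
      = if a ≤ h then μ (h - a) else 0 := by
    by_cases ha : a ≤ h
    · rw [if_pos ha]
      have e3 : ∀ i : ℕ, (μ i * if h - a = i ∧ a ≤ h then (1 : ℝ) else 0) = μ i * (if h - a = i then (1 : ℝ) else 0) := by
        intro i; simp [ha]
      simp_rw [e3]
      rw [sum_indicator μ (M + 1) (h - a)]
      split_ifs with hh
      · rfl
      · exact (hμM (h - a) (by omega)).symm
    · rw [if_neg ha]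
      refine Finset.sum_eq_zero fun i _ => ?_
      rw [if_neg (fun hc => ha hc.2), mul_zero]
  rw [s0, s1]
  ring

/-- **Blob systems are SDEC under `SDECConvClosed`.** [this work] -/
theorem blobSDEC_of_sdecConvClosed (hC : SDECConvClosed) (x : ℝ) (hx0 : 0 < x) (hx1 : x < 1) (a : ι → ℕ) (p : ι → ℝ) :
    ∀ s : Finset ι, (∀ i ∈ s, 1 ≤ a i ∧ x ≤ p i ∧ p i < 1) → SDEC x (∑ i ∈ s, a i) (blobLawOn s a p) := by
  intro s
  induction s using Finset.induction_on with
  | empty =>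
    intro _ q _ _ j' hj
    simp at hj
  | @insert i₀ s hi ih =>
    intro hs
    have hs' : ∀ i ∈ s, 1 ≤ a i ∧ x ≤ p i ∧ p i < 1 := fun i his => hs i (Finset.mem_insert_of_mem his)
    have h0 := hs i₀ (Finset.mem_insert_self _ _)
    obtain ⟨l, hl, hlaw, htop⟩ := exists_blobLaw_eq s a p
    have hgl : ∀ q ∈ l, 0 ≤ q.2 ∧ q.2 ≤ 1 := fun q hq => by
      obtain ⟨i, his, e⟩ := hl q hq; rw [e]; exact ⟨hx0.le.trans (hs' i his).2.1, (hs' i his).2.2.le⟩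
    -- law facts of `blobLawOn s` via its list form
    have n1 : ∀ h, 0 ≤ blobLawOn s a p h := fun h => by rw [← hlaw]; exact blobLaw_nonneg l hgl h
    have z1 : ∀ h, (∑ i ∈ s, a i) < h → blobLawOn s a p h = 0 := fun h hh => by
      rw [← hlaw]; exact blobLaw_eq_zero l h (by rw [htop]; exact hh)
    have m1 : ∑ h ∈ Finset.range ((∑ i ∈ s, a i) + 1), blobLawOn s a p h = 1 := by rw [← hlaw, ← htop]; exact sum_blobLaw l
    have t1 : x * ((∑ i ∈ s, a i : ℕ) : ℝ) ≤ ∑ h ∈ Finset.range ((∑ i ∈ s, a i) + 1), (h : ℝ) * blobLawOn s a p h := by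
      rw [← hlaw, ← htop, sum_mul_blobLaw]
      exact floor_mul_blobTop_le x l (fun q hq => by obtain ⟨i, his, e⟩ := hl q hq; rw [e]; exact (hs' i his).2.1)
    -- the new blob: a sure block of `a i₀` relays hung at gate `p i₀`, lowered to floor `x`
    set ν : ℕ → ℝ := gate (fun k => if k = a i₀ then (1 : ℝ) else 0) (p i₀) with hν
    have hp0 : 0 < p i₀ := lt_of_lt_of_le hx0 h0.2.1
    have dν : SDEC x (a i₀) ν := sdec_mono (sdec_gate_point (p i₀) hp0 h0.2.2.le (a i₀)) h0.2.1 h0.2.2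
    have n2 : ∀ h, 0 ≤ ν h := fun h => by simp only [hν, gate]; split_ifs <;> nlinarith [h0.2.2]
    have z2 : ∀ h, a i₀ < h → ν h = 0 := fun h hh => by
      simp only [hν, gate]; rw [if_neg (by omega), if_neg (by omega)]; ring
    have m2 : ∑ h ∈ Finset.range (a i₀ + 1), ν h = 1 := by
      rw [hν, sum_gate _ _ _ (by rw [Finset.sum_ite_eq' (Finset.range (a i₀ + 1)) (a i₀), if_pos (Finset.mem_range.2 (Nat.lt_succ_self _))])]
    have t2 : x * ((a i₀ : ℕ) : ℝ) ≤ ∑ h ∈ Finset.range (a i₀ + 1), (h : ℝ) * ν h := by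
      rw [hν, sum_mul_gate]
      have : ∑ h ∈ Finset.range (a i₀ + 1), (h : ℝ) * (if h = a i₀ then (1 : ℝ) else 0) = (a i₀ : ℝ) := by
        rw [Finset.sum_eq_single (a i₀)]
        · rw [if_pos rfl, mul_one]
        · intro h _ hne; rw [if_neg hne, mul_zero]
        · intro hn; exact absurd (Finset.mem_range.2 (Nat.lt_succ_self _)) hn
      rw [this]
      nlinarith [h0.2.1, (Nat.cast_nonneg (a i₀) : (0 : ℝ) ≤ a i₀)]
    have key := hC x (∑ i ∈ s, a i) (a i₀) (blobLawOn s a p) ν hx0 hx1 n1 z1 m1 t1 n2 z2 m2 t2 (ih hs') dν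
    rw [Finset.sum_insert hi, add_comm, blobLawOn_insert s i₀ hi, ← lconv_gate_point_eq_slice (∑ i ∈ s, a i) (a i₀) _ _ z1]
    exact key

/-- **BLOB-DEC(k) for every k from `SDECConvClosed`** (product-Bernoulli form). [this work] -/
theorem blobDEC_on_of_sdecConvClosed (hC : SDECConvClosed) (x : ℝ) (hx0 : 0 < x) (hx1 : x < 1) (s : Finset ι) (a : ι → ℕ) (p : ι → ℝ)
    (hs : ∀ i ∈ s, 1 ≤ a i ∧ x ≤ p i ∧ p i < 1) (j' : ℕ) :
    DECAt x j' (∑ i ∈ s, a i) (blobLawOn s a p) := by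
  obtain ⟨l, hl, hlaw, htop⟩ := exists_blobLaw_eq s a p
  have hgl : ∀ q ∈ l, 0 ≤ q.2 ∧ q.2 ≤ 1 := fun q hq => by
    obtain ⟨i, his, e⟩ := hl q hq; rw [e]; exact ⟨hx0.le.trans (hs i his).2.1, (hs i his).2.2.le⟩
  refine decAt_of_sdec (blobSDEC_of_sdecConvClosed hC x hx0 hx1 a p s hs) hx0 hx1
    (fun h => by rw [← hlaw]; exact blobLaw_nonneg l hgl h)
    (fun h hh => by rw [← hlaw]; exact blobLaw_eq_zero l h (by rw [htop]; exact hh))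
    (by rw [← hlaw, ← htop]; exact sum_blobLaw l) ?_ j'
  rw [← hlaw, ← htop, sum_mul_blobLaw]
  exact floor_mul_blobTop_le x l (fun q hq => by obtain ⟨i, his, e⟩ := hl q hq; rw [e]; exact (hs i his).2.1)

end LawDec

end Quant

end Summit.CriticalPhenomena.PercolationContinuityZ3.Theorems
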